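import Literature.AlgebraicGeometry.ShimuraVarieties.UnitaryAuxiliarySymplecticLevel
import Literature.NumberTheory.Automorphic.Liu2021.AppendixC.PropC5
import HarnessLib

/-!
# The twisted level homomorphism `(k, l) ↦ ũ_β(k, l⁻¹) : K × L₀ → K_δ(1)` of the symplectic embedding
# (Deligne 1971, Prop. 1.15 / (5.11.1); Deligne 1979, Prop. 2.3.10)

Topic `AlgebraicGeometry/ShimuraVarieties`; namespace `Literature.AlgebraicGeometry.ShimuraVarieties.UnitaryCanonicalModel.Aux`.
THEOREMS ONLY (no definition, no named fact, no instance; net debt 0).  Leaf (θ) of the `stub_Squot` carve of the I-1′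
receptacle (cell `hodgecm-mathlib`, crux `HDel` stmt-HodgeConjecture-24835, T3 v4.3; B-plan2 16:06:24Z (2), director s78 (2)):
the finite group `Γ = K × L₀` (modulo the product level `K_V × L_V = K̃(N)`) acts on the SOURCE of the product-level closed
immersion `ι′` by `(k, l) · ([x, aK_V], [t]) = ([x, a k⁻¹ K_V], [l t])` (★ Q4 `Aux.complexSystemExt_isLevelQuotient`) and on the
Siegel `ℚ`-model through the integral Hecke operators `act₀ γ : [J, a] ↦ [J, a γ⁻¹]` (★ D2b
`SiegelRationalModel.exists_heckeAction`).  Under `ι′` the source action reads `[J_x, ũ(a,t)] ↦ [J_x, ũ(a k⁻¹, l t)] =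
[J_x, ũ(a,t) · ũ(k⁻¹, l)] = [J_x, ũ(a,t) · γ⁻¹]` with `γ = ũ(k, l⁻¹)` — so the homomorphism through which `Γ` must act on the
target is the TWISTED one, `θ(k, l) = ũ_β(k, l⁻¹)`, which is a group homomorphism because the torus factor `T₀(M)(𝔸_f)` is
commutative.  This file supplies:

* `exists_hom_principalLevelSubgroup_of_prod_le` — for subgroups `KU ≤ U(H)(𝔸_f)`, `LT ≤ T₀(M)(𝔸_f)` with
  `KU × LT ≤ K̃(m) = ũ_β⁻¹ K_δ(m)`, a homomorphism `θ : KU × LT →* K_δ(m)` with `θ(k, l) = ũ_β(k, l⁻¹)`;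
* `exists_hom_principalLevelSubgroup_one` — the same at `m = 1` for a small level `K` and an open compact `L₀` (the exact
  shape consumed by the `stub_Squot` closer, B-p01 2026-08-28T16:02:26Z);
* `auxToGspFin_inv_mem_principalLevelSubgroup` — if `K̃(N) = K_V × L_V` (product level) then `ũ_β(k, l⁻¹) ∈ K_δ(N)` for
  `k ∈ K_V`, `l ∈ L_V` (the input of «`act₀ γ = 1` for `γ ∈ K_δ(N)`», so both actions kill `K_V × L_V`).

## References
* [Deligne1971TravauxShimura] P. Deligne, *Travaux de Shimura* (1971), Prop. 1.15 p. 132 («K₂ ⊃ u(K₁)»), §5 (5.11.1) p. 159.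
* [Deligne1979ShimuraVarieties] P. Deligne, *Variétés de Shimura* (1979), Prop. 2.3.10, 2.1.2 (PDF pp. 32, 24 of Milne's translation).
* [Milne2005ShimuraVarieties] J. S. Milne, *Introduction to Shimura Varieties* (2005), Thm. 13.6 p. 118; Rem. 5.29 (c) p. 65.
-/

set_option autoImplicit false

noncomputable section

open Matrix NumberField IsDedekindDomain

namespace Literature.AlgebraicGeometry.ShimuraVarieties

namespace UnitaryCanonicalModel

namespace Aux

open Literature.AlgebraicGeometry.ModuliOfAbelianVarieties
open Literature.NumberTheory.Automorphic Literature.NumberTheory.Automorphic.UnitaryGroup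
open Literature.NumberTheory.Automorphic.Liu2021.AppendixC (C5.OpenCompactSubgroup C5.SmallLevel)

section TwistedHom

variable {L : Type} [Field L] [NumberField L] [IsCMField L] {M : Type} [Field M] [NumberField M] [IsCMField M]
  {j : L →+* M} {H : Matrix (Fin 3) (Fin 3) L} {ξ₀ ξ : M} {g : ℕ} {δ : Fin g → ℕ}

/-- **The twisted level homomorphism `θ(k, l) = ũ_β(k, l⁻¹)`.**  For subgroups `KU ≤ U(H)(𝔸_f)` and `LT ≤ T₀(M)(𝔸_f)` with
`KU × LT ≤ K̃(m) = ũ_β⁻¹(K_δ(m))` there is a group homomorphism `θ : KU × LT →* K_δ(m)` with `θ(k, l) = ũ_β(k, l⁻¹)`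
(`l ↦ l⁻¹` is a homomorphism of the COMMUTATIVE torus `T₀(M)(𝔸_f)`; membership from `(k, l⁻¹) ∈ KU × LT`).
[cite: Deligne1971TravauxShimura, Prop. 1.15 p. 132; §5 (5.11.1) p. 159] [cite: Deligne1979ShimuraVarieties, Prop. 2.3.10 (PDF p. 32)] -/
theorem exists_hom_principalLevelSubgroup_of_prod_le (F : SymplecticFrame M j H ξ₀ ξ g δ) {m : ℕ}
    (KU : Subgroup ↥(finAdelic (↥(maximalRealSubfield L)) L (IsCMField.complexConj L) 3 H))
    (LT : Subgroup ↥(torusFinAdelic M)) (hle : KU.prod LT ≤ auxLevel F m) :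
    ∃ θ : (↥KU × ↥LT) →* ↥(principalLevelSubgroup δ m),
      ∀ g : ↥KU × ↥LT, (θ g : ↥(gspFinAdelic δ)) = auxToGspFin F ((g.1 : _), ((g.2 : ↥(torusFinAdelic M)))⁻¹) := by
  -- the pair map `(k, l) ↦ (k, l⁻¹)` into `U(H)(𝔸_f) × T₀(M)(𝔸_f)` (a homomorphism: the torus is commutative)
  let π : (↥KU × ↥LT) →*
      ↥(finAdelic (↥(maximalRealSubfield L)) L (IsCMField.complexConj L) 3 H) × ↥(torusFinAdelic M) :=
    MonoidHom.prod (KU.subtype.comp (MonoidHom.fst _ _))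
      ((invMonoidHom : ↥(torusFinAdelic M) →* ↥(torusFinAdelic M)).comp (LT.subtype.comp (MonoidHom.snd _ _)))
  have hπ : ∀ g : ↥KU × ↥LT,
      π g = (((g.1 : ↥KU) : ↥(finAdelic (↥(maximalRealSubfield L)) L (IsCMField.complexConj L) 3 H)),
        ((g.2 : ↥LT) : ↥(torusFinAdelic M))⁻¹) := fun _ => rfl
  have hmem : ∀ g : ↥KU × ↥LT, (auxToGspFin F).comp π g ∈ principalLevelSubgroup δ m := by
    intro g
    rw [MonoidHom.comp_apply, ← mem_auxLevel_iff, hπ]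
    exact hle (Subgroup.mem_prod.2 ⟨g.1.2, inv_mem g.2.2⟩)
  exact ⟨((auxToGspFin F).comp π).codRestrict _ hmem, fun _ => rfl⟩

/-- **The twisted level homomorphism at `m = 1` for the levels of the receptacle**: `K` a small level of `U(H)(𝔸_f)`,
`L₀` an open compact subgroup of `T₀(M)(𝔸_f)`, `K × L₀ ≤ K̃(1)` ⇒ `θ : K × L₀ →* K_δ(1)`, `θ(k, l) = ũ_β(k, l⁻¹)` — the
homomorphism through which `K × L₀` acts on the Siegel `ℚ`-model by integral Hecke operators in the `stub_Squot` descent.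
[cite: Deligne1971TravauxShimura, §5 (5.11.1) p. 159; Prop. 1.15 p. 132] [cite: Milne2005ShimuraVarieties, Thm. 13.6 p. 118] -/
theorem exists_hom_principalLevelSubgroup_one (F : SymplecticFrame M j H ξ₀ ξ g δ)
    {K₀ : C5.OpenCompactSubgroup ↥(finAdelic (↥(maximalRealSubfield L)) L (IsCMField.complexConj L) 3 H)}
    (K : C5.SmallLevel K₀) (L₀ : C5.OpenCompactSubgroup ↥(torusFinAdelic M)) (hle1 : K.1.1.prod L₀.1 ≤ auxLevel F 1) :
    ∃ θ : (↥K.1.1 × ↥L₀.1) →* ↥(principalLevelSubgroup δ 1),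
      ∀ g : ↥K.1.1 × ↥L₀.1, (θ g : ↥(gspFinAdelic δ)) = auxToGspFin F ((g.1 : _), ((g.2 : ↥(torusFinAdelic M)))⁻¹) :=
  exists_hom_principalLevelSubgroup_of_prod_le F K.1.1 L₀.1 hle1

/-- **At a PRODUCT level both actions kill `K_V × L_V`**: if `K̃(N) = K_V × L_V` then `ũ_β(k, l⁻¹) ∈ K_δ(N)` for `k ∈ K_V`,
`l ∈ L_V` (so the Hecke operator `act₀ (θ(k,l))`, `[J, a] ↦ [J, a·θ(k,l)⁻¹]`, is the identity at level `K_δ(N)`).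
[cite: Deligne1971TravauxShimura, §5 (5.11.1) p. 159] [cite: Milne2005ShimuraVarieties, Rem. 5.29 (c) p. 65] -/
theorem auxToGspFin_inv_mem_principalLevelSubgroup (F : SymplecticFrame M j H ξ₀ ξ g δ) {N : ℕ}
    {KV : Subgroup ↥(finAdelic (↥(maximalRealSubfield L)) L (IsCMField.complexConj L) 3 H)}
    {LV : Subgroup ↥(torusFinAdelic M)} (hprod : auxLevel F N = KV.prod LV)
    {k : ↥(finAdelic (↥(maximalRealSubfield L)) L (IsCMField.complexConj L) 3 H)} {l : ↥(torusFinAdelic M)}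
    (hk : k ∈ KV) (hl : l ∈ LV) : auxToGspFin F (k, l⁻¹) ∈ principalLevelSubgroup δ N := by
  rw [← mem_auxLevel_iff, hprod]
  exact Subgroup.mem_prod.2 ⟨hk, inv_mem hl⟩

/-- Product-level version keyed on the subgroup types: for `g : K × L₀` with components in `K_V`, `L_V` and `K̃(N) = K_V × L_V`,
the value `θ g = ũ_β(g.1, g.2⁻¹)` of ANY map with the twisted formula lies in `K_δ(N)`.
[cite: Deligne1971TravauxShimura, §5 (5.11.1) p. 159] -/
theorem coe_mem_principalLevelSubgroup_of_prod (F : SymplecticFrame M j H ξ₀ ξ g δ) {m N : ℕ}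
    {KU KV : Subgroup ↥(finAdelic (↥(maximalRealSubfield L)) L (IsCMField.complexConj L) 3 H)}
    {LT LV : Subgroup ↥(torusFinAdelic M)} (hprod : auxLevel F N = KV.prod LV)
    (θ : (↥KU × ↥LT) →* ↥(principalLevelSubgroup δ m))
    (hθ : ∀ g : ↥KU × ↥LT, (θ g : ↥(gspFinAdelic δ)) = auxToGspFin F ((g.1 : _), ((g.2 : ↥(torusFinAdelic M)))⁻¹))
    (g' : ↥KU × ↥LT) (hk : (g'.1 : ↥(finAdelic (↥(maximalRealSubfield L)) L (IsCMField.complexConj L) 3 H)) ∈ KV)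
    (hl : (g'.2 : ↥(torusFinAdelic M)) ∈ LV) :
    (θ g' : ↥(gspFinAdelic δ)) ∈ principalLevelSubgroup δ N := by
  rw [hθ]
  exact auxToGspFin_inv_mem_principalLevelSubgroup F hprod hk hl

end TwistedHom

end Aux

end UnitaryCanonicalModel

end Literature.AlgebraicGeometry.ShimuraVarieties

end
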